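import Mathlib.Analysis.Calculus.MeanValue
import Mathlib.Analysis.Calculus.ContDiff.Defs
import Mathlib.Analysis.Calculus.FDeriv.Prod
import Mathlib.Analysis.Calculus.FDeriv.RestrictScalars
import Mathlib.Analysis.Complex.Basic
import Mathlib.Tactic.LinearCombination
import Literature.Geometry.Symplectic.JHolomorphicMap

/-!
# Helper `helper_normalComponentInequality` of line `Sketch` for crux `WitnessCharge`
(item stmt-SmoothPoincare4-7824, route `SullivanDual`, crux
`Summit.SmoothPoincare4.SmoothPoincare4.Theses.SullivanDual.WitnessCharge`; registered stub
`helper_normalComponentInequality`)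

The similarity-principle input of McDuff's intersection dichotomy for two `J`-holomorphic
branches. In coordinates `q = (q₁, q₂) ∈ ℂ × ℂ` straightening the regular branch to the axis
`{q₂ = 0}`, with the almost complex structure `M` equal to multiplication by `i` ON the axis, let
`f = (f¹, f²)` be `M`-holomorphic on a disc, `df(iζ) = M(f) df(ζ)`, with `f 0 = 0`. Writing
`∂ₛ = d(·)(1)` and `∂ₜ = d(·)(i)`:

* (i) the NORMAL component satisfies the `∂̄`-inequality `‖∂ₛ f² + i ∂ₜ f²‖ ≤ K ‖f²‖` near `0`:
  `∂ₜ f - i ∂ₛ f = (M(f z) - M((f z)₁, 0)) ∂ₛ f` and `‖M(q) - M(q₁, 0)‖ ≤ C ‖q₂‖` by the mean value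
  inequality on a compact convex ball inside `U` (bound `C` of the continuous derivative of `M`),
  while `‖∂ₛ f‖ ≤ D` near `0`; take second components and `K = C D`;
* (ii) if `f² ≡ 0` near `0` then `M(f z) = i`, so `d f¹(z)` commutes with `i` and `f¹` is complex
  differentiable near `0` (`Literature.Geometry.Symplectic.exists_restrictScalars_eq_of_map_mul_I`,
  `differentiableAt_iff_restrictScalars`).

References: D. McDuff, *The local behaviour of holomorphic curves in almost complex 4-manifolds*,
J. Differential Geom. 34 (1991), Lemma 2.7 (proof); the similarity principle as in C. Wendl,
*Lectures on holomorphic curves*, §2.7.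
-/

noncomputable section

set_option linter.dupNamespace false

open scoped ContDiff Topology
open Set Filter

namespace Summit.SmoothPoincare4.SmoothPoincare4.Theorems.WitnessCharge.PencilIncompleteness

/-- Mean value inequality near `0`: a map of class `C^∞` on an open `U ∋ 0` is Lipschitz on some
closed ball around `0` contained in `U`, with constant the bound of its (continuous) derivative on
that compact convex ball. -/
private theorem NormalComponent.exists_lipschitz_closedBall {G : Type*} [NormedAddCommGroup G]
    [NormedSpace ℝ G] {U : Set (ℂ × ℂ)} (hU : IsOpen U) (h0 : (0 : ℂ × ℂ) ∈ U) {M : ℂ × ℂ → G}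
    (hM : ContDiffOn ℝ ∞ M U) :
    ∃ δ C : ℝ, 0 < δ ∧ Metric.closedBall (0 : ℂ × ℂ) δ ⊆ U ∧
      ∀ x ∈ Metric.closedBall (0 : ℂ × ℂ) δ, ∀ y ∈ Metric.closedBall (0 : ℂ × ℂ) δ,
        ‖M y - M x‖ ≤ C * ‖y - x‖ := by
  obtain ⟨δ, hδ, hsub⟩ := Metric.nhds_basis_closedBall.mem_iff.mp (hU.mem_nhds h0)
  have hcont : ContinuousOn (fderiv ℝ M) (Metric.closedBall 0 δ) :=
    (hM.continuousOn_fderiv_of_isOpen hU (by simp)).mono hsub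
  obtain ⟨C, hC⟩ := (isCompact_closedBall (0 : ℂ × ℂ) δ).exists_bound_of_continuousOn hcont
  refine ⟨δ, C, hδ, hsub, fun x hx y hy => ?_⟩
  exact (convex_closedBall (0 : ℂ × ℂ) δ).norm_image_sub_le_of_norm_fderiv_le
    (fun z hz => (hM.differentiableOn (by simp)).differentiableAt (hU.mem_nhds (hsub hz)))
    hC hx hy

/-- For `f` of class `C^∞` on the disc `‖z‖ < r` with `f 0 = 0` and `δ > 0`, there is a smaller
disc `‖z‖ < ρ`, `0 < ρ ≤ r`, on which `‖f z‖ ≤ δ` (continuity at `0`) and `‖df(z)‖ ≤ D`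
(continuity of `df` on the compact disc `‖z‖ ≤ r / 2`). -/
private theorem NormalComponent.exists_radius {f : ℂ → ℂ × ℂ} {r δ : ℝ} (hr : 0 < r)
    (hδ : 0 < δ) (hf : ContDiffOn ℝ ∞ f (Metric.ball 0 r)) (hf0 : f 0 = 0) :
    ∃ ρ D : ℝ, 0 < ρ ∧ ρ ≤ r ∧
      ∀ z ∈ Metric.ball (0 : ℂ) ρ, ‖f z‖ ≤ δ ∧ ‖fderiv ℝ f z‖ ≤ D := by
  have hcont : ContinuousAt f 0 :=
    hf.continuousOn.continuousAt (Metric.isOpen_ball.mem_nhds (Metric.mem_ball_self hr))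
  obtain ⟨ρ₁, hρ₁, h₁⟩ := Metric.continuousAt_iff.mp hcont δ hδ
  have hsub : Metric.closedBall (0 : ℂ) (r / 2) ⊆ Metric.ball 0 r :=
    Metric.closedBall_subset_ball (by linarith)
  obtain ⟨D, hD⟩ := (isCompact_closedBall (0 : ℂ) (r / 2)).exists_bound_of_continuousOn
    ((hf.continuousOn_fderiv_of_isOpen Metric.isOpen_ball (by simp)).mono hsub)
  refine ⟨min ρ₁ (r / 2), D, lt_min hρ₁ (by linarith), (min_le_right _ _).trans (by linarith),
    fun z hz => ⟨?_, hD z ?_⟩⟩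
  · rw [Metric.mem_ball] at hz
    have h := h₁ (hz.trans_le (min_le_left _ _))
    rw [hf0, dist_zero_right] at h
    exact h.le
  · rw [Metric.mem_ball] at hz
    exact Metric.mem_closedBall.mpr (hz.trans_le (min_le_right _ _)).le

/-- **`∂̄`-inequality for the normal component, and holomorphy of the tangential component on
the axis.** Let `U ⊆ ℂ × ℂ` be open with `0 ∈ U`, `M : U → End_ℝ(ℂ × ℂ)` of class `C^∞` with
`M(q₁, 0) = i` on the axis, and `f : {‖z‖ < r} → U` of class `C^∞`, `f 0 = 0`, `M`-holomorphic:
`df(z)(iζ) = M(f z) (df(z) ζ)`. Then (i) there are `K` and `0 < ρ ≤ r` with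
`‖d f²(z) 1 + i • d f²(z) i‖ ≤ K ‖f²(z)‖` for `‖z‖ < ρ` (mean value inequality for `M` between
`f z` and `((f z)₁, 0)`, where `M = i`), and (ii) if `f² = 0` near `0` then `f¹` is complex
differentiable near `0` (its real derivative commutes with `i`). -/
theorem helper_normalComponentInequality :
    ∀ (U : Set (ℂ × ℂ)), IsOpen U → (0 : ℂ × ℂ) ∈ U →
    ∀ (M : ℂ × ℂ → (ℂ × ℂ →L[ℝ] ℂ × ℂ)), ContDiffOn ℝ ∞ M U →
      (∀ q₁ : ℂ, (q₁, (0 : ℂ)) ∈ U → ∀ w : ℂ × ℂ, M (q₁, 0) w = Complex.I • w) →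
    ∀ (f : ℂ → ℂ × ℂ) (r : ℝ), 0 < r → ContDiffOn ℝ ∞ f (Metric.ball 0 r) →
      Set.MapsTo f (Metric.ball 0 r) U → f 0 = 0 →
      (∀ z ∈ Metric.ball (0 : ℂ) r, ∀ ζ : ℂ,
        fderiv ℝ f z (Complex.I * ζ) = M (f z) (fderiv ℝ f z ζ)) →
      (∃ (K ρ : ℝ), 0 < ρ ∧ ρ ≤ r ∧ ∀ z ∈ Metric.ball (0 : ℂ) ρ,
        ‖fderiv ℝ (fun z => (f z).2) z 1 + Complex.I • fderiv ℝ (fun z => (f z).2) z Complex.I‖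
          ≤ K * ‖(f z).2‖) ∧
      ((∀ᶠ z in 𝓝 (0 : ℂ), (f z).2 = 0) →
        ∀ᶠ z in 𝓝 (0 : ℂ), DifferentiableAt ℂ (fun z => (f z).1) z) := by
  intro U hU h0U M hM hMaxis f r hr hf hmaps hf0 hJ
  -- `f` is differentiable on the open disc
  have hfd : ∀ z ∈ Metric.ball (0 : ℂ) r, DifferentiableAt ℝ f z := fun z hz =>
    (hf.differentiableOn (by simp)).differentiableAt (Metric.isOpen_ball.mem_nhds hz)
  refine ⟨?_, fun hev => ?_⟩
  · -- (i) the `∂̄`-inequality for the normal component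
    obtain ⟨δ, C, hδ, hδU, hC⟩ := NormalComponent.exists_lipschitz_closedBall hU h0U hM
    obtain ⟨ρ, D, hρ, hρr, hρD⟩ := NormalComponent.exists_radius hr hδ hf hf0
    refine ⟨C * D, ρ, hρ, hρr, fun z hz => ?_⟩
    have hzr : z ∈ Metric.ball (0 : ℂ) r := Metric.ball_subset_ball hρr hz
    obtain ⟨hfzδ, hfdD⟩ := hρD z hz
    have hdz : DifferentiableAt ℝ f z := hfd z hzr
    -- second components of the derivative
    have h2 : ∀ v : ℂ, fderiv ℝ (fun z => (f z).2) z v = (fderiv ℝ f z v).2 := fun v => by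
      rw [fderiv.snd hdz]
      rfl
    -- `q = f z` and `q' = ((f z)₁, 0)` lie in the closed ball, and `M q' = i`
    have hq : f z ∈ Metric.closedBall (0 : ℂ × ℂ) δ := mem_closedBall_zero_iff.mpr hfzδ
    have hq' : ((f z).1, (0 : ℂ)) ∈ Metric.closedBall (0 : ℂ × ℂ) δ := by
      rw [mem_closedBall_zero_iff, Prod.norm_mk, norm_zero, max_eq_left (norm_nonneg _)]
      exact (norm_fst_le (f z)).trans hfzδ
    have hMq' : ∀ w, M ((f z).1, 0) w = Complex.I • w := hMaxis (f z).1 (hδU hq')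
    -- key identity `∂ₜ f - i ∂ₛ f = (M q - M q') ∂ₛ f` and its norm estimate
    have hkey : fderiv ℝ f z Complex.I - Complex.I • fderiv ℝ f z 1 =
        (M (f z) - M ((f z).1, 0)) (fderiv ℝ f z 1) := by
      rw [sub_apply, hMq', ← hJ z hzr 1, mul_one]
    have hMsub : ‖M (f z) - M ((f z).1, 0)‖ ≤ C * ‖(f z).2‖ := by
      have h := hC _ hq' _ hq
      have hn : ‖f z - ((f z).1, (0 : ℂ))‖ = ‖(f z).2‖ := by
        simp [Prod.norm_def]
      rwa [hn] at h
    have hest : ‖fderiv ℝ f z Complex.I - Complex.I • fderiv ℝ f z 1‖ ≤ C * ‖(f z).2‖ * D := by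
      rw [hkey]
      refine (ContinuousLinearMap.le_opNorm _ _).trans ?_
      have h1 : ‖fderiv ℝ f z 1‖ ≤ D := by
        refine (ContinuousLinearMap.le_opNorm _ _).trans ?_
        rw [norm_one, mul_one]
        exact hfdD
      exact mul_le_mul hMsub h1 (norm_nonneg _) ((norm_nonneg _).trans hMsub)
    -- pass to second components: `∂ₛ f² + i ∂ₜ f² = i (∂ₜ f - i ∂ₛ f)²`
    rw [h2, h2]
    have hid : (fderiv ℝ f z 1).2 + Complex.I • (fderiv ℝ f z Complex.I).2 =
        Complex.I * (fderiv ℝ f z Complex.I - Complex.I • fderiv ℝ f z 1).2 := by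
      rw [Prod.snd_sub, Prod.smul_snd, smul_eq_mul, smul_eq_mul]
      linear_combination (fderiv ℝ f z 1).2 * Complex.I_mul_I
    rw [hid, norm_mul, Complex.norm_I, one_mul]
    calc ‖(fderiv ℝ f z Complex.I - Complex.I • fderiv ℝ f z 1).2‖
        ≤ ‖fderiv ℝ f z Complex.I - Complex.I • fderiv ℝ f z 1‖ := norm_snd_le _
      _ ≤ C * ‖(f z).2‖ * D := hest
      _ = C * D * ‖(f z).2‖ := by ring
  · -- (ii) if `f² = 0` near `0`, then `d f¹` commutes with `i`, so `f¹` is holomorphic near `0`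
    filter_upwards [hev, Metric.ball_mem_nhds (0 : ℂ) hr] with z hz2 hzr
    have hdz : DifferentiableAt ℝ f z := hfd z hzr
    have hfz : f z = ((f z).1, 0) := Prod.ext rfl hz2
    have hq'U : ((f z).1, (0 : ℂ)) ∈ U := by
      rw [← hfz]
      exact hmaps hzr
    have hMz : ∀ w, M (f z) w = Complex.I • w := fun w => by
      rw [hfz]
      exact hMaxis _ hq'U w
    rw [differentiableAt_iff_restrictScalars ℝ hdz.fst]
    refine Literature.Geometry.Symplectic.exists_restrictScalars_eq_of_map_mul_I _ fun ζ => ?_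
    rw [fderiv.fst hdz, ContinuousLinearMap.comp_apply, ContinuousLinearMap.comp_apply,
      hJ z hzr ζ, hMz]
    rfl

end Summit.SmoothPoincare4.SmoothPoincare4.Theorems.WitnessCharge.PencilIncompleteness
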